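import Summits.Ventures.PercRepro.GenQFlatLatticeH

/-!
# PercRepro — the flat-lattice counting rows, part L: the `j`-subsets by rank above the flat bound, at EVERY rank
(night-4, gen 12)

Part H proved the equality form of the row (G-A) at `q = 6` above the plane bound (`j ≥ 7`).  The argument is
rank-free: if every flat of rank `≤ q − 3` has at most `B` points, a subset of more than `B` points has rank
`≥ q − 2`, and every `j`-subset (`j > B`) of the trace of a rank-`(q − 2)` flat has rank exactly `q − 2`; so the
`j`-subsets of a rank-`q` set `G` are the spanning ones, the rank-`(q − 1)` ones (`SP_{s,j}`) and the `j`-subsets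
of the rank-`(q − 2)` traces, exactly:

`C(n, j) = Σ_m #Pc (n−j) m + Σ_s SP_{s,j} + Σ_s C(s, j)·NR (q−2) s`   (`ga_eq_row_gen`, `B < j ≤ n`)

— the row (G-A) of the two-level profile LP in its EQUALITY form at every level `q ≥ 3` (sheet §65 (b)); at
`q = 7` with `B = 10` (lines `≤ 3`, planes `≤ 6`, solids `≤ 10`: `ga_eq_row_seven`) it is the row the `(9, 7)`
certificates use for `j ≥ 11`.  Imports `GenQFlatLatticeH`.
-/
namespace PercRepro.Night4

open Finset ThmH SixFour GenQ PerFlat Star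

variable {α : Type*} [DecidableEq α] {M : Matroid α} [M.Finite]

omit [DecidableEq α] in
/-- A subset of `G` with more than `B` points has rank `≥ q − 2` when every flat of rank `≤ q − 3` has `≤ B`
points (`3 ≤ q`). -/
theorem le_eRk_of_flats_le {G A : Finset α} {q B : ℕ} (hq : 3 ≤ q)
    (hB : ∀ a ≤ q - 3, ∀ K ∈ flatsQ M a, K.card ≤ B) (hG : G ⊆ gr M) (hA : A ⊆ G) (hcard : B < A.card) :
    ((q - 2 : ℕ) : ℕ∞) ≤ M.eRk (A : Set α) := by
  obtain ⟨a, ha⟩ := exists_eRk_eq_nat (M := M) A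
  rw [ha]
  by_contra hlt
  have ha' : a ≤ q - 3 := by
    have : (a : ℕ∞) < ((q - 2 : ℕ) : ℕ∞) := not_le.1 hlt
    have h' : a < q - 2 := by exact_mod_cast this
    omega
  have hflat : clF M A ∈ flatsQ M a := by
    rw [mem_flatsQ, ← Finset.coe_subset, coe_clF, coe_gr]
    exact ⟨M.closure_subset_ground _, M.isFlat_closure _, by rw [M.eRk_closure_eq, ha]⟩
  have hAcl : A ⊆ clF M A := by
    intro y hy
    rw [mem_clF]
    refine M.subset_closure _ ?_ (Finset.mem_coe.2 hy)
    rw [← coe_gr M]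
    exact Finset.coe_subset.2 (hA.trans hG)
  have hcard' := Finset.card_le_card hAcl
  have := hB a ha' _ hflat
  omega

/-- A `j`-subset of the trace of a rank-`(q − 2)` flat with `j > B` has rank exactly `q − 2`. -/
theorem eRk_eq_of_subset_flat_of_flats_le {G F A : Finset α} {q B : ℕ} (hq : 3 ≤ q)
    (hB : ∀ a ≤ q - 3, ∀ K ∈ flatsQ M a, K.card ≤ B) (hG : G ⊆ gr M) (hF : F ∈ flatsQ M (q - 2))
    (hA : A ⊆ F ∩ G) (hcard : B < A.card) : M.eRk (A : Set α) = ((q - 2 : ℕ) : ℕ∞) := by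
  have hF' := mem_flatsQ.1 hF
  refine le_antisymm ?_ (le_eRk_of_flats_le hq hB hG (hA.trans Finset.inter_subset_right) hcard)
  rw [← hF'.2.2]
  exact M.eRk_mono (Finset.coe_subset.2 (hA.trans Finset.inter_subset_left))

/-- **(G-A), the equality form at every rank**: for `3 ≤ q`, every flat of rank `≤ q − 3` with `≤ B` points and
`B < j ≤ n`, `C(n, j) = Σ_m #Pc (n−j) m + Σ_s SP_{s,j} + Σ_s C(s, j)·NR (q−2) s`. -/
theorem ga_eq_row_gen {G : Finset α} {q B : ℕ} (hq : 3 ≤ q)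
    (hB : ∀ a ≤ q - 3, ∀ K ∈ flatsQ M a, K.card ≤ B) (hG : G ⊆ gr M)
    (hrG : M.eRk (G : Set α) = (q : ℕ∞)) {j : ℕ} (hBj : B < j) (hj : j ≤ G.card) :
    G.card.choose j = ∑ m ∈ Finset.Icc (mTr M G) q, (Pc M G q (G.card - j) m).card
      + ∑ s ∈ Finset.range (G.card + 1), spSum M G (q - 1) s j
      + ∑ s ∈ Finset.range (G.card + 1), s.choose j * NR M G (q - 2) s := by
  classical
  rw [choose_eq_sum_card_rank_subsets hrG j]
  -- ranks `0 … q − 3` are empty for `j > B`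
  have hzero : ∀ ρ ∈ Finset.range (q - 2),
      ((G.powersetCard j).filter (fun T : Finset α => M.eRk (T : Set α) = (ρ : ℕ∞))).card = 0 := by
    intro ρ hρ
    rw [Finset.mem_range] at hρ
    rw [Finset.card_eq_zero, Finset.filter_eq_empty_iff]
    intro T hT hTr
    rw [Finset.mem_powersetCard] at hT
    have h4 := le_eRk_of_flats_le hq hB hG hT.1 (by omega)
    rw [hTr] at h4
    have : q - 2 ≤ ρ := by exact_mod_cast h4
    omega
  have hsplit : ∑ ρ ∈ Finset.range (q + 1),
      ((G.powersetCard j).filter (fun T : Finset α => M.eRk (T : Set α) = (ρ : ℕ∞))).card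
      = ((G.powersetCard j).filter (fun T : Finset α => M.eRk (T : Set α) = (q : ℕ∞))).card
        + ((G.powersetCard j).filter (fun T : Finset α => M.eRk (T : Set α) = ((q - 1 : ℕ) : ℕ∞))).card
        + ((G.powersetCard j).filter (fun T : Finset α => M.eRk (T : Set α) = ((q - 2 : ℕ) : ℕ∞))).card := by
    have e : q + 1 = (q - 2) + 1 + 1 + 1 := by omega
    rw [e, Finset.sum_range_succ, Finset.sum_range_succ, Finset.sum_range_succ, Finset.sum_eq_zero hzero]
    have e1 : q - 2 + 1 = q - 1 := by omega
    have e2 : q - 2 + 1 + 1 = q := by omega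
    rw [e1, e2]
    ring
  rw [hsplit, card_rank_q_subsets_eq_sum_Pc hG hrG hj, h2_row hG (q - 1) j, card_rank_eq_eq_sum_flats hG j (q - 2)]
  congr 1
  -- the rank-`(q − 2)` flats: every `j`-subset of such a trace has rank `q − 2`
  have hfib : ∑ s ∈ Finset.range (G.card + 1), s.choose j * NR M G (q - 2) s
      = ∑ F ∈ flatsQ M (q - 2), (F ∩ G).card.choose j := by
    unfold NR
    rw [← Finset.sum_fiberwise_of_maps_to (s := flatsQ M (q - 2)) (t := Finset.range (G.card + 1))
      (g := fun F : Finset α => (F ∩ G).card) (fun F _ => Finset.mem_coe.2 (Finset.mem_range.2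
        (Nat.lt_succ_of_le (Finset.card_le_card Finset.inter_subset_right))))]
    refine Finset.sum_congr rfl (fun s _ => ?_)
    rw [Finset.card_eq_sum_ones, Finset.mul_sum, mul_one]
    refine Finset.sum_congr rfl (fun F hF => ?_)
    rw [(Finset.mem_filter.1 hF).2]
  rw [hfib]
  refine Finset.sum_congr rfl (fun F hF => ?_)
  rw [← Finset.card_powersetCard]
  rw [Finset.card_filter_eq_iff]
  intro A hA
  rw [Finset.mem_powersetCard] at hA
  exact eRk_eq_of_subset_flat_of_flats_le hq hB hG hF hA.1 (by omega)

/-- The flats of rank `≤ 4` of the core have `≤ 10` points (simple; lines `≤ 3`, planes `≤ 6`, solids `≤ 10`). -/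
theorem flats_le_four_card_le_ten (hs : Simple M) (hline : ∀ L ∈ flatsQ M 2, L.card ≤ 3)
    (hplane : ∀ P ∈ flatsQ M 3, P.card ≤ 6) (hsolid : ∀ F ∈ flatsQ M 4, F.card ≤ 10) :
    ∀ a ≤ 7 - 3, ∀ K ∈ flatsQ M a, K.card ≤ 10 := by
  intro a ha K hK
  rcases Nat.lt_or_ge a 2 with h1 | h2
  · have := card_le_one_of_flatsQ_le_one hs (by omega : a ≤ 1) hK
    omega
  · rcases Nat.lt_or_ge a 3 with h3 | h4
    · have ha2 : a = 2 := by omega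
      rw [ha2] at hK
      have := hline _ hK
      omega
    · rcases Nat.lt_or_ge a 4 with h5 | h6
      · have ha3 : a = 3 := by omega
        rw [ha3] at hK
        have := hplane _ hK
        omega
      · have ha4 : a = 4 := by omega
        rw [ha4] at hK
        exact hsolid _ hK

/-- **(G-A), the equality form at `q = 7`, `j ≥ 11`** (the `(9, 7)` row):
`C(n, j) = Σ_m #Pc (n−j) m + Σ_s SP_{s,j} + Σ_s C(s, j)·NR 5 s`. -/
theorem ga_eq_row_seven (hs : Simple M) (hline : ∀ L ∈ flatsQ M 2, L.card ≤ 3)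
    (hplane : ∀ P ∈ flatsQ M 3, P.card ≤ 6) (hsolid : ∀ F ∈ flatsQ M 4, F.card ≤ 10)
    {G : Finset α} (hG : G ⊆ gr M) (hrG : M.eRk (G : Set α) = ((7 : ℕ) : ℕ∞)) {j : ℕ} (h11 : 11 ≤ j)
    (hj : j ≤ G.card) :
    G.card.choose j = ∑ m ∈ Finset.Icc (mTr M G) 7, (Pc M G 7 (G.card - j) m).card
      + ∑ s ∈ Finset.range (G.card + 1), spSum M G 6 s j
      + ∑ s ∈ Finset.range (G.card + 1), s.choose j * NR M G 5 s :=
  ga_eq_row_gen (B := 10) (by norm_num) (flats_le_four_card_le_ten hs hline hplane hsolid) hG hrG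
    (by omega) hj

end PercRepro.Night4
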